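/-
Copyright (c) 2026 the pub-hodgecm-mathlib formalisation cell (harness21).  Prover seat hodgecm-mathlib-LH7-p06 (g3), req620 Track A «(D-RAM) FOUR-FRAME» squad
((β₂) road (R-36), lane C (RamM) UPPER-LINE RAY PROGRAM of LH7-p10 (g3), file G5: the «Gen» re-issue of ★ p864078 §2–§3 (LH7-p10 (g3)) serving BOTH lanes), 2026-09-05.
-/
import Summits.HodgeConjecture.HodgeConjecture.Theorems.F0P3cDyRamRowCellSocketFibre          -- ★ p864078 (LH7-p10 (g3)): §1 `socketFibre_eq_sphereFibre` BY NAME; brings ★ p863983, ★ p863604, ★ p863524, ★ p863859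
import HarnessLib

/-!
# Crux `H413`, line LH4 «(D-RAM) FOUR-FRAME» — (β₂) road, RAY bands of BOTH lanes: «(hF) IN SOCKET SHAPE, GENERIC `jE`» — ★ p864078 `…RowCellSocketFibre` §2–§3
# (`ncard_socketFibre_eq_of_lit`, HEAD `fibre_ncard_eq_of_lit_of_gen`) with the ONE binder swap `hjiso ↦ (hjϖlt : |jEϖ| < 1)` (file G5 of LH7-p10 (g3)'s LANE-C RAY PROGRAM v1, 5eec38bd)

Cell `hodgecm-mathlib` (D-0151), FLOOR 0, crux item H413 = `stmt-HodgeConjecture-24833`, route of record `HCCMUnconditional`; squads F0∕P3c∕LH4 + LH7 (hand LH7-p06); lane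
`--supports stmt-HodgeConjecture-24833 --as helper` (count-neutral; pays NO tier-0 row).  THEOREMS ONLY (no `def`, no instance, no notation, no `sorry`, default heartbeats);
★-only imports; states NO law; (β₂) and the RAY-band letters stay HYPOTHESES.
WHAT.  ★ p864078 (LH7-p10 (g3)) proves, in lane B (RamK: `jE` ISOMETRIC, binder `hjiso : ∀ a, |jE a| = |a|`), that the count socket's fibres over any two LITERAL digits are
equinumerous ((hF) of ★ p863833 ∕ ★ p863807 in socket shape).  Its proof uses `hjiso` ONLY at two lines: `|jEϖ| < 1` and `|jEϖ| ≠ 0` (LANEC-RAY-PROGRAM v1 §0, row G5).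
THIS FILE = ★ §2–§3 re-issued with the binder swap `(hjiso : …) ↦ (hjϖlt : Valued.v (jE ϖ) < 1)` IN PLACE (binder ORDER kept, so callers pass arguments positionally exactly as
to ★; `|jEϖ| ≠ 0` is derived from the datum's `|ϖ| = exp(−1)` through `map_ne_zero jE` — no isometry, no new binder); conclusions BYTE-IDENTICAL to ★.  It serves lane B
(`hjϖlt := by rw [hjiso, hϖ]; …`) and lane C (RamM: `|jE a| = |a|²`, `|jEϖ| = exp(−2) < 1` by ★ `v_map_varpi_eq`).  §1 of ★ (`socketFibre_eq_sphereFibre`) is `jE`-free already —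
imported BY NAME, not copied.
* §2 `ncard_socketFibre_eq_of_lit` (two literal digits), §3 HEAD `fibre_ncard_eq_of_lit_of_gen` ((hF) over `Rd.filter LIT`).
HONEST LABEL.  Count-neutral algebra; nothing printed is asserted; no census law is stated; ‹HU_RAY_C♮›∕‹HL_RAY_C♭›∕‹HC_RAY_C♮›, lane B's RAY payers elsewhere, β₂
`stub_law_cleanSgn₂` stay OPEN∕HYPOTHESES; `HC_CM` is proved only modulo the 7 printed citations (2 remaining named inputs: hLiu418 = `stmt-HodgeConjecture-24832`,
h413 = `stmt-HodgeConjecture-24833`) until rung 0 closes.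
## References
* [Kottwitz1986BaseChangeUnits] R. E. Kottwitz, *Base change for unit elements of Hecke algebras*, Compositio Math. 60 (1986): §1 pp. 240–241, §3 (digit fibration of a cone cell).
* [Flicker1998UnitaryFL] Y. Z. Flicker, *Elementary proof of the fundamental lemma for a unitary group*, Canad. J. Math. 50 (1998): Prop. 7 p. 84.
* [Jacobowitz1962] R. Jacobowitz, *Hermitian forms over local fields*, Amer. J. Math. 84 (1962): §4 (norm classes of hermitian lines).
* [Serre1979] J.-P. Serre, *Local Fields*, GTM 67 (1979): Ch. V §3 Cor. 3 pp. 85–87; Ch. XIV §6.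
-/

set_option autoImplicit false

noncomputable section

namespace Summit.HodgeConjecture.HodgeConjecture.Cruxes.H413.F0P3cDyRamRowCellSocketFibreGen

open scoped Valued WithZero
open WithZero Finset
open Literature.NumberTheory.Automorphic.UnitaryThreeFourFrame (IsRamifiedQuadraticDatum)
open Summit.HodgeConjecture.HodgeConjecture.Cruxes.H413.F0P3cDyRamToricCensusDefs
open Summit.HodgeConjecture.HodgeConjecture.Cruxes.H413.F0P3cDyRamRowVertexPopulationRead (fixedNorm_mul fixedNorm_inv)
open Summit.HodgeConjecture.HodgeConjecture.Cruxes.H413.F0P3cDyRamRowCellSphereTransport (ncard_fibre_eq_ncard_fibre_of_sphere)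
open Summit.HodgeConjecture.HodgeConjecture.Cruxes.H413.F0P3cDyRamRowCellDigitRealisability (exists_flip_of_sameClass)
open Summit.HodgeConjecture.HodgeConjecture.Cruxes.H413.F0P3cDyRamRowCellSocketFibre (socketFibre_eq_sphereFibre)

variable {E M : Type} [Field E] [Valued E ℤᵐ⁰] [Field M] [Valued M ℤᵐ⁰] {ρ Θ : M →+* M} {α : M}

/-! ## §2 Two literal digits carry equinumerous fibres — generic `jE` (`|jEϖ| < 1` only) -/

/-- **EQUAL FIBRES OVER TWO LITERAL DIGITS, GENERIC `jE`.**  ★ `ncard_socketFibre_eq_of_lit` with `hjiso ↦ hjϖlt`.  One-field letters (`jE`-letters with ONLY `|jEϖ| < 1`; `ρ, Θ` commuting involutions, `ρ` isometric; `Θh = h ≠ 0`); the cell `(j, b)` (`1 ≤ b`,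
`cc(α − ρα) ≠ 0`, letter `hFgap`, `hfin`); the lane-C class letters `_c12 ∕ _c13 ∕ _c20` (`|c₀| = 1`, the `Θ`-norm dichotomy of `Θ`-fixed units, a `Θ`-fixed unit whose `ρ`-norm is not in
`𝒩`); the reference pair `(κ₀, ξ₀)` (`Tr_ρ κ₀ = 1`, `Θκ₀ = κ₀`, `ρξ₀ = −ξ₀`, `Θξ₀ = ξ₀ ≠ 0`); precisions `r, r₀` with `r·|ξ₀|·|cc(α − ρα)| < |ϖE|^b` and `r·|ξ₀|·|cc(α − ρα)| ≤ r₀·|ϖE|^b`;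
the class letter `hdeep` at depth `r₀`.  THEN for two `σ`-fixed `y, y' : E` whose sphere points `κ₀ + jE y·ξ₀`, `κ₀ + jE y'·ξ₀` satisfy the two `LIT` clauses (sphere + class) the
socket fibres over `y` and `y'` are equinumerous: flip `εΘε = ρκ₂∕ρκ₁` by ★ p863604, transport by ★ p863524 at `μ = 0`, tolerance `r·|ξ₀|`.
[cite: Kottwitz1986BaseChangeUnits, §1 pp. 240–241] [cite: Flicker1998UnitaryFL, Prop. 7 p. 84] [cite: Jacobowitz1962, §4] [cite: Serre1979, Ch. XIV §6] -/
theorem ncard_socketFibre_eq_of_lit {σ : E →+* E} {ϖ : E} {d tE : ℕ} (hD : IsRamifiedQuadraticDatum σ ϖ d tE)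
    (jE : E →+* M) (hjϖlt : Valued.v (jE ϖ) < 1) (hjfix : ∀ z, ρ z = z ↔ ∃ c, jE c = z) (hΘj : ∀ c, Θ (jE c) = jE (σ c))
    (hρρ : ∀ x, ρ (ρ x) = x) (hvρ : ∀ x, Valued.v (ρ x) = Valued.v x) (hΘΘ : ∀ x, Θ (Θ x) = x) (hΘρ : ∀ x, Θ (ρ x) = ρ (Θ x))
    {hM : M} (hΘh : Θ hM = hM) (hh : hM ≠ 0) {j b : ℕ} (hb1 : 1 ≤ b) (hcc : jE ϖ ^ j * (α - ρ α) ≠ 0)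
    (hFgap : ∀ z : M, ρ z = z → Θ z = z → Valued.v (jE ϖ) < Valued.v z → Valued.v z ≤ 1 → Valued.v z = 1)
    (hfin : (levelSet ρ Θ α (jE ϖ) hM j b).Finite)
    {c₀ : M} (hc₀1 : Valued.v c₀ = 1)
    (hdich : ∀ x : M, Θ x = x → Valued.v x = 1 → (∃ z : M, z * Θ z = x) ∨ ∃ z : M, z * Θ z = c₀ * x)
    (hwit : ∃ a : M, Θ a = a ∧ Valued.v a = 1 ∧ ¬ ∃ e : M, ρ e = e ∧ e * Θ e = a * ρ a)
    {κ₀ ξ₀ : M} (hκ₀ : κ₀ + ρ κ₀ = 1) (hΘκ₀ : Θ κ₀ = κ₀) (hξ : ρ ξ₀ = -ξ₀) (hΘξ : Θ ξ₀ = ξ₀) (hξ0 : ξ₀ ≠ 0)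
    {r r₀ : ℤᵐ⁰} (hrR : r * Valued.v ξ₀ * Valued.v (jE ϖ ^ j * (α - ρ α)) < Valued.v (jE ϖ) ^ b)
    (hr₀ : r * Valued.v ξ₀ * Valued.v (jE ϖ ^ j * (α - ρ α)) ≤ r₀ * Valued.v (jE ϖ) ^ b)
    (hdeep : ∀ u : M, ρ u = u → Θ u = u → Valued.v (u - 1) ≤ r₀ → ∃ c : M, ρ c = c ∧ c * Θ c = u)
    (ε : Prop) {y y' : E} (hσy : σ y = y) (hσy' : σ y' = y')
    (hy : Valued.v (κ₀ + jE y * ξ₀) * Valued.v (jE ϖ ^ j * (α - ρ α)) = Valued.v (jE ϖ) ^ b ∧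
      ∃ e : M, ρ e = e ∧ e * Θ e = (κ₀ + jE y * ξ₀) * ρ (κ₀ + jE y * ξ₀) / (hM * ρ hM))
    (hy' : Valued.v (κ₀ + jE y' * ξ₀) * Valued.v (jE ϖ ^ j * (α - ρ α)) = Valued.v (jE ϖ) ^ b ∧
      ∃ e : M, ρ e = e ∧ e * Θ e = (κ₀ + jE y' * ξ₀) * ρ (κ₀ + jE y' * ξ₀) / (hM * ρ hM)) :
    {Λ : AddSubgroup M | ∃ x₀ : M, (x₀ ≠ 0 ∧ (∀ x, x ∈ Λ ↔ ∃ ζ, IsOrd ρ α (jE ϖ ^ j) ζ ∧ x = x₀ * ζ) ∧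
        IsOrd ρ α (jE ϖ ^ j) (dualGen ρ Θ α (jE ϖ ^ j) hM x₀) ∧ ¬ IsOrd ρ α (jE ϖ ^ j) (dualGen ρ Θ α (jE ϖ ^ j) hM x₀ / jE ϖ) ∧
        Valued.v (dualGen ρ Θ α (jE ϖ ^ j) hM x₀) = Valued.v (jE ϖ) ^ b) ∧
        ((∃ e : M, ρ e = e ∧ e * Θ e = hM * (x₀ * Θ x₀) + ρ (hM * (x₀ * Θ x₀))) ↔ ε) ∧
        Valued.v ((ρ (hM * (x₀ * Θ x₀)) / (hM * (x₀ * Θ x₀) + ρ (hM * (x₀ * Θ x₀))) - κ₀) / ξ₀ - jE y) ≤ r}.ncard =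
      {Λ : AddSubgroup M | ∃ x₀ : M, (x₀ ≠ 0 ∧ (∀ x, x ∈ Λ ↔ ∃ ζ, IsOrd ρ α (jE ϖ ^ j) ζ ∧ x = x₀ * ζ) ∧
        IsOrd ρ α (jE ϖ ^ j) (dualGen ρ Θ α (jE ϖ ^ j) hM x₀) ∧ ¬ IsOrd ρ α (jE ϖ ^ j) (dualGen ρ Θ α (jE ϖ ^ j) hM x₀ / jE ϖ) ∧
        Valued.v (dualGen ρ Θ α (jE ϖ ^ j) hM x₀) = Valued.v (jE ϖ) ^ b) ∧
        ((∃ e : M, ρ e = e ∧ e * Θ e = hM * (x₀ * Θ x₀) + ρ (hM * (x₀ * Θ x₀))) ↔ ε) ∧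
        Valued.v ((ρ (hM * (x₀ * Θ x₀)) / (hM * (x₀ * Θ x₀) + ρ (hM * (x₀ * Θ x₀))) - κ₀) / ξ₀ - jE y') ≤ r}.ncard := by
  obtain ⟨-, -, hϖ, -⟩ := id hD
  -- `jE ϖ`: a `ρ`-fixed non-zero element of valuation `< 1`
  have hρϖ : ρ (jE ϖ) = jE ϖ := (hjfix _).2 ⟨ϖ, rfl⟩
  have hϖlt : Valued.v (jE ϖ) < 1 := hjϖlt
  have hϖE0 : ϖ ≠ 0 := fun h0 => by rw [h0, Valuation.map_zero] at hϖ; exact exp_ne_zero hϖ.symm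
  have hϖ0 : jE ϖ ≠ 0 := (map_ne_zero jE).2 hϖE0
  have hvϖ0 : Valued.v (jE ϖ) ≠ 0 := (Valuation.ne_zero_iff _).2 hϖ0
  have hρj : ∀ c' : E, ρ (jE c') = jE c' := fun c' => (hjfix _).2 ⟨c', rfl⟩
  have hccpos : (0 : ℤᵐ⁰) < Valued.v (jE ϖ ^ j * (α - ρ α)) := zero_lt_iff.2 ((Valuation.ne_zero_iff _).2 hcc)
  -- the two sphere points
  set κ₁ : M := κ₀ + jE y * ξ₀ with hκ₁def
  set κ₂ : M := κ₀ + jE y' * ξ₀ with hκ₂def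
  obtain ⟨hR₁, hQ₁⟩ := hy
  obtain ⟨hR₂, hQ₂⟩ := hy'
  have hκ₁tr : κ₁ + ρ κ₁ = 1 := by rw [hκ₁def, map_add, map_mul, hρj, hξ, ← hκ₀]; ring
  have hκ₂tr : κ₂ + ρ κ₂ = 1 := by rw [hκ₂def, map_add, map_mul, hρj, hξ, ← hκ₀]; ring
  have hΘκ₁ : Θ κ₁ = κ₁ := by rw [hκ₁def, map_add, map_mul, hΘj, hσy, hΘκ₀, hΘξ]
  have hΘκ₂ : Θ κ₂ = κ₂ := by rw [hκ₂def, map_add, map_mul, hΘj, hσy', hΘκ₀, hΘξ]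
  have hκ₂v : Valued.v κ₂ = Valued.v κ₁ := mul_right_cancel₀ hccpos.ne' (by rw [hR₂, hR₁])
  have hvκ₁ : Valued.v κ₁ ≠ 0 := fun h0 => by rw [h0, zero_mul] at hR₁; exact pow_ne_zero _ hvϖ0 hR₁.symm
  have hκ₁0 : κ₁ ≠ 0 := (Valuation.ne_zero_iff _).1 hvκ₁
  have hpos₁ : (0 : ℤᵐ⁰) < Valued.v κ₁ := zero_lt_iff.2 hvκ₁
  -- the two points lie in one `Q`-class: `Q(κ₂)∕Q(κ₁) = (Q(κ₂)∕N_ρ h)·(Q(κ₁)∕N_ρ h)⁻¹ ∈ 𝒩`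
  have hNh0 : hM * ρ hM ≠ 0 := mul_ne_zero hh ((map_ne_zero ρ).2 hh)
  have hQ : ∃ e : M, ρ e = e ∧ e * Θ e = (κ₂ * ρ κ₂) / (κ₁ * ρ κ₁) := by
    have e : (κ₂ * ρ κ₂) / (κ₁ * ρ κ₁) = ((κ₂ * ρ κ₂) / (hM * ρ hM)) * ((κ₁ * ρ κ₁) / (hM * ρ hM))⁻¹ := by
      rw [← div_eq_mul_inv, div_div_div_cancel_right₀ hNh0]
    rw [e]
    exact fixedNorm_mul hQ₂ (fixedNorm_inv hQ₁)
  -- the flip exists (★ p863604)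
  obtain ⟨εf, hεf⟩ := exists_flip_of_sameClass hρρ hvρ hΘρ hc₀1 hdich hwit hΘκ₁ hΘκ₂ hκ₁0 hκ₂v hQ
  -- the precision letters at tolerance `r·|ξ₀|`
  have hr : r * Valued.v ξ₀ < Valued.v κ₁ := lt_of_mul_lt_mul_right (by rw [hR₁]; exact hrR) hccpos.le
  have hrr₀ : r * Valued.v ξ₀ ≤ r₀ * Valued.v κ₁ := le_of_mul_le_mul_right (by rw [mul_assoc r₀, hR₁]; exact hr₀) hccpos
  have hΔle : Valued.v (κ₂ - κ₁) ≤ Valued.v κ₁ := (Valuation.map_sub _ _ _).trans (max_le hκ₂v.le le_rfl)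
  have hrτ : Valued.v (κ₂ - κ₁) * (r * Valued.v ξ₀) ≤ r₀ * Valued.v κ₁ ^ 2 :=
    calc Valued.v (κ₂ - κ₁) * (r * Valued.v ξ₀) ≤ Valued.v κ₁ * (r₀ * Valued.v κ₁) := mul_le_mul' hΔle hrr₀
      _ = r₀ * Valued.v κ₁ ^ 2 := by rw [pow_two, mul_left_comm]
  have hμ : Valued.v (0 : M) ≤ (Valued.v (jE ϖ) ^ b) ^ 2 := by rw [Valuation.map_zero]; exact zero_le
  -- ★ p863524 at `μ = 0`, read through §1
  rw [socketFibre_eq_sphereFibre (ρ := ρ) (Θ := Θ) (α := α) jE ϖ hM j b hξ0 r ε y,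
    socketFibre_eq_sphereFibre (ρ := ρ) (Θ := Θ) (α := α) jE ϖ hM j b hξ0 r ε y']
  exact ncard_fibre_eq_ncard_fibre_of_sphere (α := α) (μ := (0 : M)) hρρ hvρ hΘΘ hΘρ hΘh hρϖ hϖ0 hϖlt hb1 hcc hμ hFgap hdeep hκ₁tr hκ₂tr hΘκ₁ hΘκ₂
    hR₁ hκ₂v hr hrτ hεf ε hfin

/-! ## §3 HEAD — (hF) in socket shape -/

/-- **HEAD — (hF) «THE FIBRES OVER ANY TWO LITERAL DIGITS ARE EQUINUMEROUS», SOCKET SHAPE, GENERIC `jE`.**  ★ `fibre_ncard_eq_of_lit_of_gen` with `hjiso ↦ hjϖlt`.  Letters of §2, a digit system `Rd` of `σ`-fixed elements, and an abstract literal predicate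
`LIT` with the letter `hLIT : ∀ V ∈ Rd, LIT V → (sphere ∧ class)` (★ p863983's conclusion for the consumer's `LIT`).  THEN the (hF) hypothesis of ★ p863833
`cellDiff_eq_zero_of_fibration_reads₃` ∕ ★ p863807 VERBATIM, with `CLS x₀ :≡ ∃ e, ρe = e ∧ eΘe = t(x₀)`, `Vf x₀ :≡ (κ̂(x₀) − κ₀) ∕ ξ₀` (★ p863914's instantiations):
`∀ y ∈ Rd.filter LIT, ∀ y' ∈ Rd.filter LIT, #{Λ ∣ ∃ x₀, GEN Λ x₀ ∧ (CLS x₀ ↔ ε) ∧ |Vf x₀ − jE y| ≤ r} = #{… y' …}`.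
[cite: Kottwitz1986BaseChangeUnits, §1 pp. 240–241] [cite: Flicker1998UnitaryFL, Prop. 7 p. 84] [cite: Jacobowitz1962, §4] [cite: Serre1979, Ch. V §3 Cor. 3; Ch. XIV §6] -/
theorem fibre_ncard_eq_of_lit_of_gen {σ : E →+* E} {ϖ : E} {d tE : ℕ} (hD : IsRamifiedQuadraticDatum σ ϖ d tE)
    (jE : E →+* M) (hjϖlt : Valued.v (jE ϖ) < 1) (hjfix : ∀ z, ρ z = z ↔ ∃ c, jE c = z) (hΘj : ∀ c, Θ (jE c) = jE (σ c))
    (hρρ : ∀ x, ρ (ρ x) = x) (hvρ : ∀ x, Valued.v (ρ x) = Valued.v x) (hΘΘ : ∀ x, Θ (Θ x) = x) (hΘρ : ∀ x, Θ (ρ x) = ρ (Θ x))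
    {hM : M} (hΘh : Θ hM = hM) (hh : hM ≠ 0) {j b : ℕ} (hb1 : 1 ≤ b) (hcc : jE ϖ ^ j * (α - ρ α) ≠ 0)
    (hFgap : ∀ z : M, ρ z = z → Θ z = z → Valued.v (jE ϖ) < Valued.v z → Valued.v z ≤ 1 → Valued.v z = 1)
    (hfin : (levelSet ρ Θ α (jE ϖ) hM j b).Finite)
    {c₀ : M} (hc₀1 : Valued.v c₀ = 1)
    (hdich : ∀ x : M, Θ x = x → Valued.v x = 1 → (∃ z : M, z * Θ z = x) ∨ ∃ z : M, z * Θ z = c₀ * x)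
    (hwit : ∃ a : M, Θ a = a ∧ Valued.v a = 1 ∧ ¬ ∃ e : M, ρ e = e ∧ e * Θ e = a * ρ a)
    {κ₀ ξ₀ : M} (hκ₀ : κ₀ + ρ κ₀ = 1) (hΘκ₀ : Θ κ₀ = κ₀) (hξ : ρ ξ₀ = -ξ₀) (hΘξ : Θ ξ₀ = ξ₀) (hξ0 : ξ₀ ≠ 0)
    {r r₀ : ℤᵐ⁰} (hrR : r * Valued.v ξ₀ * Valued.v (jE ϖ ^ j * (α - ρ α)) < Valued.v (jE ϖ) ^ b)
    (hr₀ : r * Valued.v ξ₀ * Valued.v (jE ϖ ^ j * (α - ρ α)) ≤ r₀ * Valued.v (jE ϖ) ^ b)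
    (hdeep : ∀ u : M, ρ u = u → Θ u = u → Valued.v (u - 1) ≤ r₀ → ∃ c : M, ρ c = c ∧ c * Θ c = u)
    (ε : Prop) (Rd : Finset E) (hRdσ : ∀ V ∈ Rd, σ V = V) (LIT : E → Prop) [DecidablePred LIT]
    (hLIT : ∀ V ∈ Rd, LIT V → Valued.v (κ₀ + jE V * ξ₀) * Valued.v (jE ϖ ^ j * (α - ρ α)) = Valued.v (jE ϖ) ^ b ∧
      ∃ e : M, ρ e = e ∧ e * Θ e = (κ₀ + jE V * ξ₀) * ρ (κ₀ + jE V * ξ₀) / (hM * ρ hM)) :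
    ∀ y ∈ Rd.filter LIT, ∀ y' ∈ Rd.filter LIT,
      {Λ : AddSubgroup M | ∃ x₀ : M, (x₀ ≠ 0 ∧ (∀ x, x ∈ Λ ↔ ∃ ζ, IsOrd ρ α (jE ϖ ^ j) ζ ∧ x = x₀ * ζ) ∧
        IsOrd ρ α (jE ϖ ^ j) (dualGen ρ Θ α (jE ϖ ^ j) hM x₀) ∧ ¬ IsOrd ρ α (jE ϖ ^ j) (dualGen ρ Θ α (jE ϖ ^ j) hM x₀ / jE ϖ) ∧
        Valued.v (dualGen ρ Θ α (jE ϖ ^ j) hM x₀) = Valued.v (jE ϖ) ^ b) ∧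
        ((∃ e : M, ρ e = e ∧ e * Θ e = hM * (x₀ * Θ x₀) + ρ (hM * (x₀ * Θ x₀))) ↔ ε) ∧
        Valued.v ((ρ (hM * (x₀ * Θ x₀)) / (hM * (x₀ * Θ x₀) + ρ (hM * (x₀ * Θ x₀))) - κ₀) / ξ₀ - jE y) ≤ r}.ncard =
      {Λ : AddSubgroup M | ∃ x₀ : M, (x₀ ≠ 0 ∧ (∀ x, x ∈ Λ ↔ ∃ ζ, IsOrd ρ α (jE ϖ ^ j) ζ ∧ x = x₀ * ζ) ∧
        IsOrd ρ α (jE ϖ ^ j) (dualGen ρ Θ α (jE ϖ ^ j) hM x₀) ∧ ¬ IsOrd ρ α (jE ϖ ^ j) (dualGen ρ Θ α (jE ϖ ^ j) hM x₀ / jE ϖ) ∧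
        Valued.v (dualGen ρ Θ α (jE ϖ ^ j) hM x₀) = Valued.v (jE ϖ) ^ b) ∧
        ((∃ e : M, ρ e = e ∧ e * Θ e = hM * (x₀ * Θ x₀) + ρ (hM * (x₀ * Θ x₀))) ↔ ε) ∧
        Valued.v ((ρ (hM * (x₀ * Θ x₀)) / (hM * (x₀ * Θ x₀) + ρ (hM * (x₀ * Θ x₀))) - κ₀) / ξ₀ - jE y') ≤ r}.ncard := by
  intro y hy y' hy'
  obtain ⟨hyR, hyL⟩ := mem_filter.1 hy
  obtain ⟨hyR', hyL'⟩ := mem_filter.1 hy'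
  exact ncard_socketFibre_eq_of_lit (α := α) hD jE hjϖlt hjfix hΘj hρρ hvρ hΘΘ hΘρ hΘh hh hb1 hcc hFgap hfin hc₀1 hdich hwit hκ₀ hΘκ₀ hξ hΘξ hξ0 hrR hr₀ hdeep ε
    (hRdσ y hyR) (hRdσ y' hyR') (hLIT y hyR hyL) (hLIT y' hyR' hyL')

end Summit.HodgeConjecture.HodgeConjecture.Cruxes.H413.F0P3cDyRamRowCellSocketFibreGen

end
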